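import Summits.CriticalPhenomena.PercolationContinuityZ3.Theorems.PercNearOneGluingNoHeavyLowerTailThreePointProductFormFibreTwoPortLocality
import HarnessLib

/-!
# The product form `#bad² ≤ #P1·#P2` in the fibre language: THE NETWORK-SIDE COUNTS OF THE SUBSTITUTION THEOREM
# (Sahi programme, prover prim-sahi-p2 gen 55)

Support file (`--supports stmt-CriticalPhenomena-4575`, helper); third part of the formalisation of reduction R4 (memo
`run/shared/lean/prim/prim-sahi/FROM-prim-sahi-p2-gen55-REDUCTIONS.md` §3).  Standard axioms, no sorries, no named facts, no definitions (auxiliary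
objects are functions with defining clauses, as in `…FibreTwoPortSubstitution`).

In the master lemma `bad_iff_restBad` the network `N` enters only through the NETWORK EVENT
`NE(e, πp, πq, e')(z) :≡ (p ↔ q in zn z ↔ e) ∧ (p ↔ q in Fn z πp πq ↔ e')` (virtual edge before / after the flat, for the port pattern `(πp, πq)`).
This file computes `ν(e, πp, πq, e') := #NE(e, πp, πq, e')` in terms of the three ANTITHETIC CLASS SIZES of the network,
  `A' = #{p ↔ q in zn w and in zn w̄}`,  `CD' = #{p ↔ q in zn w, p ↮ q in zn w̄}`,  `DD' = #{p ↮ q in zn w and in zn w̄}`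
(`w̄` the complement; all counts over the whole configuration space, i.e. `2^{#rest labels}` times the network's own counts), by transporting the
interface identities of `…FibreTwoTerminal` / `…FibreTwoClusterFlip` to the auxiliary multigraph `endsN` (the rest labels made loops at `p`, so that
its open connections are those of the network part, `reachable_endsN_iff`):
* `net_flip_p / net_flip_q / net_flip_pq` [this work] — the network flips `Fn z 1 0`, `Fn z 0 1`, `Fn z 1 1` are the network parts of
  `clusterFlip endsN p z̄`, `clusterFlip endsN q z̄` and of the two-cluster flip `μ_{p,q} z̄`;
* **`nu_table`** [this work] — for the pattern `(0,0)`: `ν(e,0,0,e') = [e = e']·(e ? A' + CD' : CD' + DD')`; for the three other patterns: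
  `ν(1,π,1) = A'`, `ν(1,π,0) = CD'`, `ν(0,π,1) = CD'`, `ν(0,π,0) = DD'`.
[folklore] (bijection counting); [cite: Gladkov2024, Conjecture 10.1 (p. 18), arXiv:2408.08457] for CONJECTURE (P).
-/

namespace Summit.CriticalPhenomena.PercolationContinuityZ3.Theorems.ProductFormFibre

open Finset Literature.Probability.Percolation
open Summit.CriticalPhenomena.PercolationContinuityZ3.Theorems.ThreePointCPIClusterSwap
  (CReach QTouch clusterFlip clusterFlip_of_qtouch clusterFlip_of_not_qtouch)

variable {V α : Type*}

section NetCounts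

variable (ends endsN : α → Sym2 V) (p q : V) (inN : α → Prop)
  (hE1 : ∀ l, inN l → endsN l = ends l) (hE2 : ∀ l, ¬ inN l → endsN l = s(p, p))
  (zn : (α → Bool) → α → Bool)
  (hzn : ∀ z l, inN l → zn z l = z l) (hzn0 : ∀ z l, ¬ inN l → zn z l = false)
  (Fn : (α → Bool) → Bool → Bool → α → Bool)
  (hFn1 : ∀ z πp πq l, inN l →
    ((πp = true ∧ ∃ v ∈ ends l, (openGraph (labelledOpen ends (zn z))).Reachable p v) ∨
      (πq = true ∧ ∃ v ∈ ends l, (openGraph (labelledOpen ends (zn z))).Reachable q v)) → Fn z πp πq l = !z l)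
  (hFn2 : ∀ z πp πq l, inN l →
    ¬ ((πp = true ∧ ∃ v ∈ ends l, (openGraph (labelledOpen ends (zn z))).Reachable p v) ∨
      (πq = true ∧ ∃ v ∈ ends l, (openGraph (labelledOpen ends (zn z))).Reachable q v)) → Fn z πp πq l = z l)
  (hFn0 : ∀ z πp πq l, ¬ inN l → Fn z πp πq l = false)

/-! ### 1. The auxiliary multigraph `endsN`: its open graph is the open graph of the network part -/

include hE1 hE2 hzn hzn0 in
/-- The open graph of `w` on `endsN` (rest labels are loops) is the open graph of the network part `zn w` on `ends`. [this work] -/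
theorem openGraph_endsN (w : α → Bool) : openGraph (labelledOpen endsN w) = openGraph (labelledOpen ends (zn w)) := by
  ext u v
  rw [openGraph_adj, openGraph_adj]
  constructor
  · rintro ⟨⟨l, hl, hle⟩, huv⟩
    by_cases hin : inN l
    · exact ⟨⟨l, by rw [hzn w l hin]; exact hl, by rw [← hE1 l hin]; exact hle⟩, huv⟩
    · exfalso; apply huv
      rw [hE2 l hin] at hle
      have h1 : u ∈ (s(p, p) : Sym2 V) := by rw [hle]; exact Sym2.mem_mk_left u v
      have h2 : v ∈ (s(p, p) : Sym2 V) := by rw [hle]; exact Sym2.mem_mk_right u v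
      rw [Sym2.mem_iff, or_self] at h1 h2
      rw [h1, h2]
  · rintro ⟨⟨l, hl, hle⟩, huv⟩
    by_cases hin : inN l
    · exact ⟨⟨l, by rw [← hzn w l hin]; exact hl, by rw [hE1 l hin]; exact hle⟩, huv⟩
    · rw [hzn0 w l hin] at hl; exact absurd hl Bool.false_ne_true

include hE1 hE2 hzn hzn0 in
/-- Open connections on `endsN` are the open connections of the network part. [this work] -/
theorem reachable_endsN_iff (w : α → Bool) (x y : V) :
    (openGraph (labelledOpen endsN w)).Reachable x y ↔ (openGraph (labelledOpen ends (zn w))).Reachable x y := by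
  rw [openGraph_endsN ends endsN p inN hE1 hE2 zn hzn hzn0 w]

include hE1 hE2 hzn hzn0 in
/-- On a network label, 'touching the closed cluster of `t` in `z̄` on `endsN`' is 'touching the `zn z`-cluster of `t`'. [this work] -/
theorem qtouch_endsN_iff (t : V) (z : α → Bool) {l : α} (hl : inN l) :
    QTouch endsN t (fun x => !z x) l ↔ ∃ v ∈ ends l, (openGraph (labelledOpen ends (zn z))).Reachable t v := by
  rw [qtouch_compl_iff, hE1 l hl]
  simp only [reachable_endsN_iff ends endsN p inN hE1 hE2 zn hzn hzn0]

/-! ### 2. The three network flips as network parts of flips on `endsN` -/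

include hE1 hE2 hzn hzn0 hFn1 hFn2 hFn0 in
/-- The network flip for the pattern `(1,0)` is the network part of `clusterFlip endsN p z̄`. [this work] -/
theorem net_flip_p (z : α → Bool) : zn (clusterFlip endsN p fun x => !z x) = Fn z true false := by
  classical
  funext l
  by_cases hl : inN l
  · rw [hzn _ l hl]
    by_cases h : ∃ v ∈ ends l, (openGraph (labelledOpen ends (zn z))).Reachable p v
    · rw [clusterFlip_of_qtouch endsN p _ ((qtouch_endsN_iff ends endsN p inN hE1 hE2 zn hzn hzn0 p z hl).2 h),
        hFn1 z true false l hl (Or.inl ⟨rfl, h⟩)]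
    · rw [clusterFlip_of_not_qtouch endsN p _ (fun h' => h ((qtouch_endsN_iff ends endsN p inN hE1 hE2 zn hzn hzn0 p z hl).1 h')),
        Bool.not_not, hFn2 z true false l hl (by rintro (⟨-, h'⟩ | ⟨h', -⟩); exacts [h h', Bool.false_ne_true h'])]
  · rw [hzn0 _ l hl, hFn0 z true false l hl]

include hE1 hE2 hzn hzn0 hFn1 hFn2 hFn0 in
/-- The network flip for the pattern `(0,1)` is the network part of `clusterFlip endsN q z̄`. [this work] -/
theorem net_flip_q (z : α → Bool) : zn (clusterFlip endsN q fun x => !z x) = Fn z false true := by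
  classical
  funext l
  by_cases hl : inN l
  · rw [hzn _ l hl]
    by_cases h : ∃ v ∈ ends l, (openGraph (labelledOpen ends (zn z))).Reachable q v
    · rw [clusterFlip_of_qtouch endsN q _ ((qtouch_endsN_iff ends endsN p inN hE1 hE2 zn hzn hzn0 q z hl).2 h),
        hFn1 z false true l hl (Or.inr ⟨rfl, h⟩)]
    · rw [clusterFlip_of_not_qtouch endsN q _ (fun h' => h ((qtouch_endsN_iff ends endsN p inN hE1 hE2 zn hzn hzn0 q z hl).1 h')),
        Bool.not_not, hFn2 z false true l hl (by rintro (⟨h', -⟩ | ⟨-, h'⟩); exacts [Bool.false_ne_true h', h h'])]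
  · rw [hzn0 _ l hl, hFn0 z false true l hl]

include hE1 hE2 hzn hzn0 hFn1 hFn2 hFn0 in
open Classical in
/-- The network flip for the pattern `(1,1)` is the network part of the two-cluster flip `μ_{p,q} z̄` on `endsN`. [this work] -/
theorem net_flip_pq (z : α → Bool) :
    zn (fun l => if QTouch endsN p (fun x => !z x) l ∨ QTouch endsN q (fun x => !z x) l then (fun x => !z x) l else !(fun x => !z x) l) =
      Fn z true true := by
  funext l
  by_cases hl : inN l
  · rw [hzn _ l hl]
    by_cases h : (true = true ∧ ∃ v ∈ ends l, (openGraph (labelledOpen ends (zn z))).Reachable p v) ∨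
        (true = true ∧ ∃ v ∈ ends l, (openGraph (labelledOpen ends (zn z))).Reachable q v)
    · have h' : QTouch endsN p (fun x => !z x) l ∨ QTouch endsN q (fun x => !z x) l := by
        rcases h with ⟨-, h⟩ | ⟨-, h⟩
        · exact Or.inl ((qtouch_endsN_iff ends endsN p inN hE1 hE2 zn hzn hzn0 p z hl).2 h)
        · exact Or.inr ((qtouch_endsN_iff ends endsN p inN hE1 hE2 zn hzn hzn0 q z hl).2 h)
      simp only [h', if_true, hFn1 z true true l hl h]
    · have h' : ¬ (QTouch endsN p (fun x => !z x) l ∨ QTouch endsN q (fun x => !z x) l) := by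
        rintro (h' | h')
        · exact h (Or.inl ⟨rfl, (qtouch_endsN_iff ends endsN p inN hE1 hE2 zn hzn hzn0 p z hl).1 h'⟩)
        · exact h (Or.inr ⟨rfl, (qtouch_endsN_iff ends endsN p inN hE1 hE2 zn hzn hzn0 q z hl).1 h'⟩)
      simp only [h', if_false, Bool.not_not, hFn2 z true true l hl h]
  · simp only [hzn0 _ l hl, hFn0 z true true l hl]

include hzn hzn0 hFn2 hFn0 in
/-- The network flip for the empty pattern is the network part itself. [this work] -/
theorem net_flip_none (z : α → Bool) : Fn z false false = zn z := by
  funext l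
  by_cases hl : inN l
  · rw [hzn z l hl, hFn2 z false false l hl (by rintro (⟨h, -⟩ | ⟨h, -⟩) <;> exact Bool.false_ne_true h)]
  · rw [hzn0 z l hl, hFn0 z false false l hl]

/-! ### 3. The values `ν(e, πp, πq, e')` -/

variable [Fintype α] [DecidableEq α]

include hE1 hE2 hzn hzn0 hFn1 hFn2 hFn0 in
open Classical in
/-- **The after-flat virtual edge for a nonempty pattern, counted against the before state**: for each of the patterns `(1,0)`, `(0,1)`, `(1,1)`,
`#{p ↮ q in zn z, p ↔ q in Fn z π} = CD'` and `#{p ↔ q in zn z, p ↔ q in Fn z π} = A'`. [this work] -/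
theorem nu_nonempty (πp πq : Bool) (hπ : πp = true ∨ πq = true) :
    (univ.filter fun z : α → Bool => ¬ (openGraph (labelledOpen ends (zn z))).Reachable p q ∧
        (openGraph (labelledOpen ends (Fn z πp πq))).Reachable p q).card =
      (univ.filter fun w : α → Bool => (openGraph (labelledOpen ends (zn w))).Reachable p q ∧
        ¬ (openGraph (labelledOpen ends (zn fun l => !w l))).Reachable p q).card ∧
    (univ.filter fun z : α → Bool => (openGraph (labelledOpen ends (zn z))).Reachable p q ∧
        (openGraph (labelledOpen ends (Fn z πp πq))).Reachable p q).card =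
      (univ.filter fun w : α → Bool => (openGraph (labelledOpen ends (zn w))).Reachable p q ∧
        (openGraph (labelledOpen ends (zn fun l => !w l))).Reachable p q).card := by
  have hR := reachable_endsN_iff ends endsN p inN hE1 hE2 zn hzn hzn0
  -- express everything on `endsN`
  have eTarget1 : (univ.filter fun w : α → Bool => (openGraph (labelledOpen ends (zn w))).Reachable p q ∧
        ¬ (openGraph (labelledOpen ends (zn fun l => !w l))).Reachable p q) =
      (univ.filter fun w : α → Bool => (openGraph (labelledOpen endsN w)).Reachable p q ∧
        ¬ (openGraph (labelledOpen endsN fun l => !w l)).Reachable p q) :=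
    Finset.filter_congr fun w _ => by rw [hR, hR]
  have eTarget2 : (univ.filter fun w : α → Bool => (openGraph (labelledOpen ends (zn w))).Reachable p q ∧
        (openGraph (labelledOpen ends (zn fun l => !w l))).Reachable p q) =
      (univ.filter fun w : α → Bool => (openGraph (labelledOpen endsN w)).Reachable p q ∧
        (openGraph (labelledOpen endsN fun l => !w l)).Reachable p q) :=
    Finset.filter_congr fun w _ => by rw [hR, hR]
  rw [eTarget1, eTarget2]
  rcases Bool.eq_false_or_eq_true πp with hp1 | hp0 <;> rcases Bool.eq_false_or_eq_true πq with hq1 | hq0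
  · -- pattern (1,1): the two-cluster flip
    subst hp1; subst hq1
    have hF : ∀ z : α → Bool, (openGraph (labelledOpen ends (Fn z true true))).Reachable p q ↔
        (openGraph (labelledOpen endsN (fun l => if QTouch endsN p (fun x => !z x) l ∨ QTouch endsN q (fun x => !z x) l
          then (fun x => !z x) l else !(fun x => !z x) l))).Reachable p q := by
      intro z; rw [hR, net_flip_pq ends endsN p q inN hE1 hE2 zn hzn hzn0 Fn hFn1 hFn2 hFn0 z]
    have hkeep : ∀ (w : α → Bool) (l : α), (QTouch endsN p w l ∨ QTouch endsN q w l) →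
        (fun w l => if QTouch endsN p w l ∨ QTouch endsN q w l then w l else !w l) w l = w l :=
      fun w l h => by simp only [h, if_true]
    have hflip : ∀ (w : α → Bool) (l : α), ¬ (QTouch endsN p w l ∨ QTouch endsN q w l) →
        (fun w l => if QTouch endsN p w l ∨ QTouch endsN q w l then w l else !w l) w l = !w l :=
      fun w l h => by simp only [h, if_false]
    constructor
    · rw [← card_virtual_two_eq_card_conn_not_compl endsN p q _ hkeep hflip]
      exact congrArg Finset.card (Finset.filter_congr fun z _ => by rw [hR, hF])
    · rw [← card_filter_twoFlip_eq_card_filter_compl endsN p q _ hkeep hflip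
        (fun z => (openGraph (labelledOpen endsN z)).Reachable p q) (fun z => (openGraph (labelledOpen endsN z)).Reachable p q)
        (fun _ _ h => (h q).1)]
      exact congrArg Finset.card (Finset.filter_congr fun z _ => by rw [hR, hF])
  · -- pattern (1,0): flip at `p`
    subst hp1; subst hq0
    have hF : ∀ z : α → Bool, (openGraph (labelledOpen ends (Fn z true false))).Reachable p q ↔
        (openGraph (labelledOpen endsN (clusterFlip endsN p fun x => !z x))).Reachable p q := by
      intro z; rw [hR, net_flip_p ends endsN p q inN hE1 hE2 zn hzn hzn0 Fn hFn1 hFn2 hFn0 z]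
    constructor
    · rw [← card_virtual_eq_card_conn_not_compl endsN p q]
      exact congrArg Finset.card (Finset.filter_congr fun z _ => by rw [hR, hF])
    · rw [← card_conn_flat_eq_card_ambi endsN p q]
      exact congrArg Finset.card (Finset.filter_congr fun z _ => by rw [hR, hF])
  · -- pattern (0,1): flip at `q`; the identities at `q` speak of `q ↔ p`, so symmetrise
    subst hp0; subst hq1
    have hF : ∀ z : α → Bool, (openGraph (labelledOpen ends (Fn z false true))).Reachable p q ↔
        (openGraph (labelledOpen endsN (clusterFlip endsN q fun x => !z x))).Reachable q p := by
      intro z; rw [hR, net_flip_q ends endsN p q inN hE1 hE2 zn hzn hzn0 Fn hFn1 hFn2 hFn0 z]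
      exact ⟨SimpleGraph.Reachable.symm, SimpleGraph.Reachable.symm⟩
    have hS : ∀ w : α → Bool, (openGraph (labelledOpen endsN w)).Reachable p q ↔ (openGraph (labelledOpen endsN w)).Reachable q p :=
      fun w => ⟨SimpleGraph.Reachable.symm, SimpleGraph.Reachable.symm⟩
    have hRs : ∀ z : α → Bool, (openGraph (labelledOpen endsN z)).Reachable q p ↔ (openGraph (labelledOpen ends (zn z))).Reachable p q :=
      fun z => by rw [hR]; exact ⟨SimpleGraph.Reachable.symm, SimpleGraph.Reachable.symm⟩
    constructor
    · rw [show (univ.filter fun w : α → Bool => (openGraph (labelledOpen endsN w)).Reachable p q ∧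
            ¬ (openGraph (labelledOpen endsN fun l => !w l)).Reachable p q) =
          (univ.filter fun w : α → Bool => (openGraph (labelledOpen endsN w)).Reachable q p ∧
            ¬ (openGraph (labelledOpen endsN fun l => !w l)).Reachable q p) from
          Finset.filter_congr fun w _ => by rw [hS, hS],
        ← card_virtual_eq_card_conn_not_compl endsN q p]
      exact congrArg Finset.card (Finset.filter_congr fun z _ => by rw [hRs z, hF z])
    · rw [show (univ.filter fun w : α → Bool => (openGraph (labelledOpen endsN w)).Reachable p q ∧
            (openGraph (labelledOpen endsN fun l => !w l)).Reachable p q) =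
          (univ.filter fun w : α → Bool => (openGraph (labelledOpen endsN w)).Reachable q p ∧
            (openGraph (labelledOpen endsN fun l => !w l)).Reachable q p) from
          Finset.filter_congr fun w _ => by rw [hS, hS],
        ← card_conn_flat_eq_card_ambi endsN q p]
      exact congrArg Finset.card (Finset.filter_congr fun z _ => by rw [hRs z, hF z])
  · -- pattern (0,0) is excluded
    subst hp0; subst hq0
    rcases hπ with h | h <;> exact absurd h Bool.false_ne_true

end NetCounts

end Summit.CriticalPhenomena.PercolationContinuityZ3.Theorems.ProductFormFibre
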